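import Literature.MathematicalPhysics.QuantumFieldTheory.Balaban1983to89.Node00.Record13NumericsOfThm1CCMZ

/-!
# THE NORMALISATION COVARIANCE OF THE RECORD TOWER — the letters `(Efl, logz)` of a Stage-13 parameter enter EVERY slot ∕ density ∕ T-density of record ONLY
# through ONE positive constant per run, `e^{E_θ(p) − E_{θ'}(p)}`, and the LIVE SELECTOR of record is letter-free; hence the z-WITNESS OF RECORD
# `theta13OfThm1CCMWZ … e z` (DEF-1 Z2) has the coupling-blind witness's densities times `exp (E_W p − E_Z p)`, with `E_Z p − E_W p = Σ_{j<K} (e p j − z p j·(L⁴−1)|T₁^{(j+1)}|)`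

Cell `pub-ymgap`, WIDTH SEAT `pub-ymgap-dag-n24-w1` (gen 5).  `--kind proof --supports stmt-QuantumFields-27364 --as helper` (K1⁹ `StabilityBRunRowsAtRecordR13SepCoPHV`, DECIDING; dag-lead KEY
MAP v2); count-neutral.  THESES-FREE (imports DEF-1's Z2 `Node00/Record13NumericsOfThm1CCMZ` only).  LOCATED by dag-n24-c g12 (E-DEPENDENCE CENSUS, pub-ymgap bus 2026-08-28T13:27:42Z:
«every slot ∕ density ∕ rep of record at `θᶻ` is `exp(E_θ(p) − E_θᶻ(p))` times the one at `θ` … an `E`-covariance theorem of the tower is typable (induction on `texpAOfRecord_succ`)»); typed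
here by the width seat with dag-n24-c's first refusal on the bus.
[I] = [Balaban1987RG1]; [III] = [Balaban1988Convergent]; [IV] = [Balaban1989LargeFieldI]; [V] = [Balaban1989LargeFieldII].

WHY (director-ym №218 FLAG №9 «K1-FACE DOOR WITNESS COUPLING-BLIND»).  K0a's all-numerics witness family `theta13OfThm1CCMW` has `Efl ≡ 0`, `logz ≡ 0`; dag-n13-w3's no-go (p637054) retires it
as the `θ` of K1⁹'s conclusion; the repair is DEF-1's z-edition `theta13OfThm1CCMWZ … e z` (Z2, p639492) with the letters OPEN, and every lane re-keys its faces there.  The E-FREE faces (β,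
histories, carriers, admissibility) transfer by `rfl` (dag-n24-c's census; k0-s1-w3 ∕ n13-w1 kernel checks).  THIS FILE settles the E-READING faces STRUCTURALLY: `E` enters the tower only as the
factor `e^{−E(p)}` of `ρ₀` ([III] Thm 1 p. 262), the T-step (†) ([III] (3.1) p. 264) is linear in the slot (Bochner integral against the one-step kernel), the R-step ([IV] (0.3) p. 176) is
POSITIVELY HOMOGENEOUS (its fibre-integral ratios are scale-free), and liveness of a sequence (K0a's `LiveSeq`, the live selector `ppSelLiveOfRecord` of `Node00/Record12LiveSelector`) is
scale-free — so by induction on the level every slot family scales by `c_p := e^{E_θ(p) − E_{θ'}(p)} > 0` and the live selector does not move.  At the z-witness (which IS `liveRepin₁₃` of the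
re-keyed all-numerics pre-witness): `densOfRecord₁₃ (θ₁₅ᶜᶜᴹᵂᶻ(…; e, z)) p k = exp (E_W p − E_Z p) · densOfRecord₁₃ (θ₁₅ᶜᶜᴹᵂ) p k` pointwise, `ppSel` identical, and `E_Z p − E_W p` is the
displayed letter sum.  CONSEQUENCE FOR THE LANES (stated, not typed here): every E-reading face at the z-witness (densities, `𝐓ρ`, reps' slots, `SlotsNondegenerate₁₃`, the (S)∕(T) laws,
`Provisos.intPiece ∕ rstep`, N13's (2.50) readings) is the blind witness's face up to the run-constant `c_p` — a positive scalar per run that non-degeneracy and homogeneous laws ignore and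
that log-density bounds shift by `log c_p = E_W(p) − E_Z(p)` exactly (the quantity N13's Cor-3 window, p625602, weighs).

CONTENTS (0 `def`, 0 `sorry`; [folklore] finite-sum ∕ integral algebra over landed Node00 definitions; nothing of Bałaban asserted).
§1 homogeneities: `rhoZeroOfRecord_eq_exp_mul` · `tstepOfRecord_const_mul` (any real `c`) · `fibreIntegral_const_mul` (`0 ≤ c`; the `DecidableEq` instance a unifiable implicit) ·
`rstepOfSel_TexpA_const_mul` (generic `Step.Repr218`, `0 < c`) · `rstepSlot_const_mul`.
§2 the tower at a fixed selector: `slotsOfRecord_eq_exp_mul` · `slotsTOfRecord_eq_exp_mul` · `rhoOfRecord9_eq_exp_mul` · `trhoOfRecord9_eq_exp_mul`.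
§2b the live tower: `choose_congr_pred` · `liveSeq_const_mul` · `liveSelOfSlot_const_mul` · ★ `ppSelLive_eq_and_liveSlots_eq_exp_mul` · ★ `ppSelLiveOfRecord_eq_of_normalisation`.
§3 Stage 13, fixed selector: `densOfRecord₁₃_reKey_eq_exp_mul` (`θᶻ := { θ with Efl := e, logz := z }`).
§3b Stage 13, live re-pin: `liveRepin₁₃_reKey_ppSel` · ★ `densOfRecord₁₃_liveRepin_reKey_eq_exp_mul`.
§4 the named z-witness (Z2): ★ `ppSel_theta13OfThm1CCMWZ` · ★★ `densOfRecord₁₃_theta13OfThm1CCMWZ_eq_exp_mul` · `tdensOfRecord₁₃_theta13OfThm1CCMWZ_eq_exp_mul`.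
§5 the constant: `EOfRecord_sub_EOfRecord` · ★ `EOfRecord₁₃_theta13OfThm1CCMWZ_sub`.
§6 a first E-reading row transferred: ★ `slotsNondegenerate₁₃_theta13OfThm1CCMWZ_iff`.

HONEST FRAMING.  Kernel bookkeeping about the TREE's record objects (how the tree's normalisation letters propagate through the tree's tower); NOTHING of Bałaban is asserted, proved or refuted;
no estimate; no stub of K0⁷ ∕ K1⁹ ∕ K3⁸ proved; nothing registered; the z-witness's letters `e`, `z` stay OPEN (no (0.15) value pinned); FLAG №9 is NOT closed by this file (it names no
door-keyed closer); N13 ∕ N24 NOT discharged; N24 COMPOSITE; counts UNMOVED (typed 28∕28 · discharged 5∕27 (A 5∕28)).  One finite 𝕋⁴ programme at fixed `ε = L^{−K}`, Bałaban AS PRINTED —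
route R4 closes the CONDITIONAL finite-𝕋⁴ rung `BalabanLadder.UV` only: NOT continuum, NOT ℝ⁴, NOT OS, NOT the Yang–Mills mass gap, NOT Clay.  No `sorry`, `def`, `instance`, `notation`,
`axiom`; standard axioms.
Sources (context only): [III] Thm 1 p. 262 («ρ₀ = exp[−(1∕g₀²)A − E]»), (1.15) p. 249, p. 254, (2.18) p. 257, (3.1) p. 264, (3.22)–(3.25) pp. 269–270; [IV] (0.2)–(0.3) p. 176, p. 177;
[V] (0.15) p. 360 (the printed `z`); [I] (1.12) p. 262.
-/

noncomputable section

open MeasureTheory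
open scoped BigOperators ENNReal

namespace Summit.QuantumFields.YangMills.BalabanUVNodes.RecordTowerNormalisationCovariance

open Literature.MathematicalPhysics.QuantumFieldTheory.Balaban1983to89
open Literature.MathematicalPhysics.QuantumFieldTheory.Balaban1983to89.Node00
open T4Continuum

variable {F : T4Family} {N : ℕ} [NeZero N]

/-! ## §1 The three elementary homogeneities: start density, T-step, fibre integral ∕ R-step -/

/-- `ρ₀` at normalisation `E'` is `e^{E − E'}` times `ρ₀` at normalisation `E`. [cite: Balaban1988Convergent, Thm 1 p.262 (bookkeeping)] -/
theorem rhoZeroOfRecord_eq_exp_mul (K : ℕ) (g₀ E E' : ℝ) (U : cfgOfRecord F N K 0) :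
    rhoZeroOfRecord F N K g₀ E' U = Real.exp (E - E') * rhoZeroOfRecord F N K g₀ E U := by
  unfold rhoZeroOfRecord
  rw [← mul_assoc, ← Real.exp_add]
  congr 2
  ring

/-- The T-step of record is homogeneous in the slot: `𝐓(c·T) = c·𝐓T` (Bochner integral, any real `c`). [cite: Balaban1988Convergent, (3.1) p.264, (3.24)–(3.25) p.270 (bookkeeping)] -/
theorem tstepOfRecord_const_mul (ν : Stage7Numerics) (M : ℕ) (w : StepWeightsOfRecord F N ν M) (p : B12.RunParams) (g : ℕ → ℝ)
    (k : ℕ) (c : ℝ) (T : SeqOfRecord F ν M g p.K k → Density (F.P p.K) k (SU N)) :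
    tstepOfRecord F N ν M w p g k (fun s U => c * T s U) = fun s' V' => c * tstepOfRecord F N ν M w p g k T s' V' := by
  funext s' V'
  rw [tstepOfRecord_apply, tstepOfRecord_apply]
  unfold transportOfRecord T4AveragingDisintegration.transportK T4AveragingDisintegration.kernelTransport
  have : (fun U => w p g k s' U V' * (chiSeqOfRecord F N ν M g p.K k s'.init U * (c * T s'.init U)))
      = fun U => c * (w p g k s' U V' * (chiSeqOfRecord F N ν M g p.K k s'.init U * T s'.init U)) := by
    funext U; ring
  rw [this, integral_const_mul]
  ring

/-- The fibre integral is positively homogeneous: `∫⌈_s (c·f) = c·∫⌈_s f` for `0 ≤ c`. [cite: Balaban1989LargeFieldI, (0.3) p.176 (bookkeeping)] -/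
theorem fibreIntegral_const_mul {P : Params} {G : Type*} [GaugeGroup G] [MeasurableSpace G] [HaarData G] {j : ℕ} {hdec : DecidableEq (PBond P j)}
    (s : Finset (PBond P j)) {c : ℝ} (hc : 0 ≤ c) (f : Density P j G) (V : GaugeField P j G) :
    @B15.BasicStep.fibreIntegral P j G _ _ _ hdec s (fun U => c * f U) V = c * @B15.BasicStep.fibreIntegral P j G _ _ _ hdec s f V := by
  unfold B15.BasicStep.fibreIntegral lmarginal
  dsimp only
  simp only [ENNReal.ofReal_mul hc]
  rw [lintegral_const_mul' _ _ ENNReal.ofReal_ne_top, ENNReal.toReal_mul, ENNReal.toReal_ofReal hc]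

/-- The R-step on a (2.18) representation is positively homogeneous in the slot: scaling `𝐓e^A` by `c > 0` scales the R-stepped slot by `c`
(the fibre-integral ratios of (0.3) are scale-free). [cite: Balaban1989LargeFieldI, (0.3) p.176 (bookkeeping)] -/
theorem rstepOfSel_TexpA_const_mul {P : Params} {G : Type*} [GaugeGroup G] [MeasurableSpace G] [HaarData G] {j : ℕ}
    (r : Step.Repr218 P G j) (sel : r.Adm → r.Adm) (fib : r.Adm → Finset (PBond P j)) {c : ℝ} (hc : 0 < c)
    (a' : r.Adm) (V : GaugeField P j G) :
    (rstepOfSel { r with TexpA := fun a V => c * r.TexpA a V } sel fib).TexpA a' V = c * (rstepOfSel r sel fib).TexpA a' V := by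
  classical
  have hr : ∀ a, rratio { r with TexpA := fun a V => c * r.TexpA a V } fib a a' V = rratio r fib a a' V := by
    intro a
    unfold rratio
    have e1 : ∀ b : r.Adm, rterm ({ r with TexpA := fun a V => c * r.TexpA a V } : Step.Repr218 P G j) b = fun V => c * rterm r b V := by
      intro b; funext U
      show r.χ b U * (c * r.TexpA b U) = c * (r.χ b U * r.TexpA b U)
      ring
    rw [e1, e1, fibreIntegral_const_mul _ hc.le, fibreIntegral_const_mul _ hc.le, mul_div_mul_left _ _ hc.ne']
  rw [rstepOfSel_TexpA, rstepOfSel_TexpA]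
  rw [Finset.sum_congr rfl fun a _ => hr a]
  show c * r.TexpA a' V * _ = _
  ring

/-- The R-step of record ON SLOTS is positively homogeneous: `R(c·f) = c·R f` for `0 < c`. [cite: Balaban1989LargeFieldI, (0.3) p.176 (bookkeeping)] -/
theorem rstepSlot_const_mul (ν : Stage7Numerics) (τ : TowerNumerics) (p : B12.RunParams) (g : ℕ → ℝ) (k : ℕ)
    (sel : SeqOfRecord F ν τ.M g p.K k → SeqOfRecord F ν τ.M g p.K k) {c : ℝ} (hc : 0 < c) (f : TexpASlot F N ν τ.M p g k) :
    rstepSlot F N ν τ p g k sel (fun s V => c * f s V) = fun s V => c * rstepSlot F N ν τ p g k sel f s V := by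
  classical
  funext s' V
  dsimp only [rstepSlot, rstepOfSel, rratio, rterm, sliceOfRecord]
  have e1 : ∀ (b : SeqOfRecord F ν τ.M g p.K k) (U : GaugeField (F.P p.K) k (SU N)),
      chiSeqOfRecord F N ν τ.M g p.K k b U * (c * f b U) = c * (chiSeqOfRecord F N ν τ.M g p.K k b U * f b U) := fun b U => by ring
  unfold rterm
  dsimp only
  rw [mul_assoc]
  congr 1
  congr 1
  refine Finset.sum_congr rfl fun a _ => ?_
  rw [funext (e1 a), funext (e1 s'),
    fibreIntegral_const_mul (fibOfSeq F ν τ p g k a) hc.le (fun U => chiSeqOfRecord F N ν τ.M g p.K k a U * f a U),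
    fibreIntegral_const_mul (fibOfSeq F ν τ p g k a) hc.le (fun U => chiSeqOfRecord F N ν τ.M g p.K k s' U * f s' U),
    mul_div_mul_left _ _ hc.ne']

/-! ## §2 The tower: every slot ∕ density at normalisation `E'` is `e^{E p − E' p}` times the one at `E` -/

section Tower
variable (ν : Stage7Numerics) (τ : TowerNumerics) (E E' : B12.RunParams → ℝ) (w : StepWeightsOfRecord F N ν τ.M)
  (ppSel : PpSelOfRecord F ν τ.M) (p : B12.RunParams) (g : ℕ → ℝ)

/-- **E-COVARIANCE OF THE POST-𝐑 SLOT FAMILY**: `slot_k[E'] = e^{E p − E' p} · slot_k[E]` at every level (induction on the level: start density,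
linear T-step, positively homogeneous R-step). [cite: Balaban1988Convergent, Thm 1 p.262, (2.18) p.257, (3.24) p.270; Balaban1989LargeFieldI, (0.3) p.176 (bookkeeping)] -/
theorem slotsOfRecord_eq_exp_mul (k : ℕ) :
    slotsOfRecord F N ν τ E' w ppSel p g k = fun s V => Real.exp (E p - E' p) * slotsOfRecord F N ν τ E w ppSel p g k s V := by
  induction k with
  | zero =>
    funext s V
    show rhoZeroOfRecord F N p.K (g 0) (E' p) V = Real.exp (E p - E' p) * rhoZeroOfRecord F N p.K (g 0) (E p) V
    exact rhoZeroOfRecord_eq_exp_mul p.K (g 0) (E p) (E' p) V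
  | succ k ih =>
    rw [slotsOfRecord_succ, slotsOfRecord_succ, slotsTOfRecord_succ, slotsTOfRecord_succ, ih, tstepOfRecord_const_mul]
    exact rstepSlot_const_mul ν τ p g (k + 1) (ppSel p g (k + 1)) (Real.exp_pos _) _

/-- **E-COVARIANCE OF THE PRE-𝐑 SLOT FAMILY** (`𝐓ρ_k`'s slots). [cite: Balaban1988Convergent, (3.24)–(3.25) p.270 (bookkeeping)] -/
theorem slotsTOfRecord_eq_exp_mul (k : ℕ) :
    slotsTOfRecord F N ν τ E' w ppSel p g k = fun s V => Real.exp (E p - E' p) * slotsTOfRecord F N ν τ E w ppSel p g k s V := by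
  cases k with
  | zero =>
    funext s V
    rw [slotsTOfRecord_zero, slotsTOfRecord_zero]
    exact rhoZeroOfRecord_eq_exp_mul p.K (g 0) (E p) (E' p) V
  | succ k =>
    rw [slotsTOfRecord_succ, slotsTOfRecord_succ, slotsOfRecord_eq_exp_mul ν τ E E' w ppSel p g k, tstepOfRecord_const_mul]

/-- **E-COVARIANCE OF THE DENSITIES OF RECORD**: `ρ_k[E'] = e^{E p − E' p} · ρ_k[E]`. [cite: Balaban1988Convergent, (2.18) p.257, Thm 1 p.262 (bookkeeping)] -/
theorem rhoOfRecord9_eq_exp_mul (k : ℕ) (V : cfgOfRecord F N p.K k) :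
    rhoOfRecord9 F N ν τ E' w ppSel p g k V = Real.exp (E p - E' p) * rhoOfRecord9 F N ν τ E w ppSel p g k V := by
  show densityOfRepr F N ν τ.M (slotsOfRecord F N ν τ E' w ppSel) p g k V = Real.exp (E p - E' p) * densityOfRepr F N ν τ.M (slotsOfRecord F N ν τ E w ppSel) p g k V
  unfold densityOfRepr
  rw [slotsOfRecord_eq_exp_mul ν τ E E' w ppSel p g k, Finset.mul_sum]
  refine Finset.sum_congr rfl fun s _ => ?_
  ring

/-- **E-COVARIANCE OF THE T-STEPPED DENSITIES**: `𝐓ρ_k[E'] = e^{E p − E' p} · 𝐓ρ_k[E]`. [cite: Balaban1988Convergent, (3.1) p.264, (3.25) p.270 (bookkeeping)] -/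
theorem trhoOfRecord9_eq_exp_mul (k : ℕ) (V : cfgOfRecord F N p.K (k + 1)) :
    trhoOfRecord9 F N ν τ E' w ppSel p g k V = Real.exp (E p - E' p) * trhoOfRecord9 F N ν τ E w ppSel p g k V := by
  show densityOfRepr F N ν τ.M (slotsTOfRecord F N ν τ E' w ppSel) p g (k + 1) V
    = Real.exp (E p - E' p) * densityOfRepr F N ν τ.M (slotsTOfRecord F N ν τ E w ppSel) p g (k + 1) V
  unfold densityOfRepr
  rw [slotsTOfRecord_eq_exp_mul ν τ E E' w ppSel p g (k + 1), Finset.mul_sum]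
  refine Finset.sum_congr rfl fun s _ => ?_
  ring
end Tower

/-! ## §3 Stage 13: re-keying the normalisation letters `(Efl, logz)` of a Stage-13 parameter -/

section Stage13
variable (θ : Stage13Params F N) (e z : B12.RunParams → ℕ → ℝ) (p : B12.RunParams)

/-- The density of record at the re-keyed parameter `θᶻ := {θ with Efl := e, logz := z}` is `e^{E_θ(p) − E_{θᶻ}(p)}` times the density at `θ`. [cite: Balaban1988Convergent, Thm 1 p.262, (1.15) p.249, (2.18) p.257 (bookkeeping)] -/
theorem densOfRecord₁₃_reKey_eq_exp_mul (k : ℕ) (V : cfgOfRecord F N p.K k) :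
    densOfRecord₁₃ F N { θ with Efl := e, logz := z } p k V
      = Real.exp (EOfRecord₁₃ F N θ p - EOfRecord₁₃ F N { θ with Efl := e, logz := z } p) * densOfRecord₁₃ F N θ p k V :=
  rhoOfRecord9_eq_exp_mul θ.ν θ.τ9 (EOfRecord₁₃ F N θ) (EOfRecord₁₃ F N { θ with Efl := e, logz := z })
    (wOfRecord₉ F N θ.toStage9Params) θ.ppSel p (gOfRecord₁₃ F N θ p) k V
end Stage13

/-! ## §2b The LIVE SELECTOR of record is invariant under the normalisation re-key (liveness is scale-free) -/

section Live
variable (ν : Stage7Numerics) (τ : TowerNumerics)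

/-- `Classical.choose` over propositionally equal predicates agrees. [folklore] -/
theorem choose_congr_pred {α : Sort*} {P Q : α → Prop} (hPQ : P = Q) (h : ∃ x, P x) (h' : ∃ x, Q x) :
    Classical.choose h = Classical.choose h' := by
  subst hPQ; rfl

/-- Liveness of a sequence is scale-free: `LiveSeq (c·f) = LiveSeq f` for `0 < c` (as predicates). [cite: Balaban1989LargeFieldI, (0.3) p.176 and p.177 (bookkeeping)] -/
theorem liveSeq_const_mul (p : B12.RunParams) (g : ℕ → ℝ) (k : ℕ) {c : ℝ} (hc : 0 < c) (f : TexpASlot F N ν τ.M p g k) :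
    LiveSeq F N ν τ p g k (fun s V => c * f s V) = LiveSeq F N ν τ p g k f := by
  funext s
  apply propext
  unfold LiveSeq
  rw [rstepSlot_const_mul ν τ p g k id hc f]
  simp only [ne_eq, mul_eq_zero, hc.ne', false_or]

/-- The live selector of a slot family is scale-free: `liveSel (c·f) = liveSel f` for `0 < c`. [cite: Balaban1989LargeFieldI, (0.3) p.176 and p.177 (bookkeeping)] -/
theorem liveSelOfSlot_const_mul (p : B12.RunParams) (g : ℕ → ℝ) (k : ℕ) {c : ℝ} (hc : 0 < c) (f : TexpASlot F N ν τ.M p g k) :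
    liveSelOfSlot F N ν τ p g k (fun s V => c * f s V) = liveSelOfSlot F N ν τ p g k f := by
  classical
  have h := liveSeq_const_mul ν τ p g k hc f
  funext s
  by_cases hs : LiveSeq F N ν τ p g k f s
  · have hs' : LiveSeq F N ν τ p g k (fun s V => c * f s V) s := by rw [h]; exact hs
    rw [liveSelOfSlot_of_live F N hs, liveSelOfSlot_of_live F N hs']
  · by_cases hex : ∃ s', LiveSeq F N ν τ p g k f s'
    · have hex' : ∃ s', LiveSeq F N ν τ p g k (fun s V => c * f s V) s' := by rw [h]; exact hex
      have hs' : ¬ LiveSeq F N ν τ p g k (fun s V => c * f s V) s := by rw [h]; exact hs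
      unfold liveSelOfSlot
      rw [if_neg hs', if_neg hs, dif_pos hex', dif_pos hex]
      exact choose_congr_pred h hex' hex
    · have hex' : ¬ ∃ s', LiveSeq F N ν τ p g k (fun s V => c * f s V) s' := by rw [h]; exact hex
      rw [liveSelOfSlot_of_none F N hex, liveSelOfSlot_of_none F N hex']

variable (E E' : B12.RunParams → ℝ) (w : StepWeightsOfRecord F N ν τ.M) (p : B12.RunParams) (g : ℕ → ℝ)

/-- **THE LIVE TOWER UNDER A NORMALISATION RE-KEY**: at every level the live selector of record is UNCHANGED and the live slot family is scaled by
`e^{E p − E' p}` (simultaneous induction on the level). [cite: Balaban1988Convergent, Thm 1 p.262, (3.22)–(3.24) pp.269–270; Balaban1989LargeFieldI, (0.3) p.176 (bookkeeping)] -/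
theorem ppSelLive_eq_and_liveSlots_eq_exp_mul (k : ℕ) :
    ppSelLiveOfRecord F N ν τ E' w p g k = ppSelLiveOfRecord F N ν τ E w p g k ∧
      liveSlotsOfRecord F N ν τ E' w p g k = fun s V => Real.exp (E p - E' p) * liveSlotsOfRecord F N ν τ E w p g k s V := by
  induction k with
  | zero =>
    refine ⟨rfl, ?_⟩
    funext s V
    exact rhoZeroOfRecord_eq_exp_mul p.K (g 0) (E p) (E' p) V
  | succ k ih =>
    have hT : tstepOfRecord F N ν τ.M w p g k (liveSlotsOfRecord F N ν τ E' w p g k)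
        = fun s' V' => Real.exp (E p - E' p) * tstepOfRecord F N ν τ.M w p g k (liveSlotsOfRecord F N ν τ E w p g k) s' V' := by
      rw [ih.2, tstepOfRecord_const_mul]
    have hsel : liveSelOfSlot F N ν τ p g (k + 1) (tstepOfRecord F N ν τ.M w p g k (liveSlotsOfRecord F N ν τ E' w p g k))
        = liveSelOfSlot F N ν τ p g (k + 1) (tstepOfRecord F N ν τ.M w p g k (liveSlotsOfRecord F N ν τ E w p g k)) := by
      rw [hT, liveSelOfSlot_const_mul ν τ p g (k + 1) (Real.exp_pos _)]
    refine ⟨?_, ?_⟩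
    · rw [ppSelLiveOfRecord_succ, ppSelLiveOfRecord_succ, hsel]
    · show rstepSlot F N ν τ p g (k + 1) _ _ = fun s V => Real.exp (E p - E' p) * rstepSlot F N ν τ p g (k + 1) _ _ s V
      rw [hsel, hT, rstepSlot_const_mul ν τ p g (k + 1) _ (Real.exp_pos _)]

/-- **★ THE LIVE SELECTOR OF RECORD IS E-INVARIANT**: `ppSelLiveOfRecord E' w = ppSelLiveOfRecord E w`. [cite: Balaban1989LargeFieldI, (0.3) p.176 and p.177 (bookkeeping)] -/
theorem ppSelLiveOfRecord_eq_of_normalisation : ppSelLiveOfRecord F N ν τ E' w = ppSelLiveOfRecord F N ν τ E w := by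
  funext p g k
  exact (ppSelLive_eq_and_liveSlots_eq_exp_mul ν τ E E' w p g k).1
end Live

/-! ## §3b Stage 13 with the LIVE re-pin: the witnesses of record `(…).liveRepin₁₃` -/

section Stage13Live
variable (θ : Stage13Params F N) (e z : B12.RunParams → ℕ → ℝ) (p : B12.RunParams)

/-- The live re-pin's selector is UNCHANGED by the `(Efl, logz)` re-key. [cite: Balaban1989LargeFieldI, (0.3) p.176 and p.177 (bookkeeping)] -/
theorem liveRepin₁₃_reKey_ppSel :
    (({ θ with Efl := e, logz := z } : Stage13Params F N).liveRepin₁₃ F N).ppSel = (θ.liveRepin₁₃ F N).ppSel :=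
  ppSelLiveOfRecord_eq_of_normalisation θ.ν θ.τ9 (EOfRecord₁₃ F N θ) (EOfRecord₁₃ F N { θ with Efl := e, logz := z })
    (wOfRecord₉ F N θ.toStage9Params)

/-- **★ THE DENSITIES OF RECORD AT THE LIVE RE-PIN OF THE RE-KEYED PARAMETER = `e^{E_θ(p) − E_{θᶻ}(p)}` × THOSE AT THE LIVE RE-PIN OF `θ`.** [cite: Balaban1988Convergent, Thm 1 p.262, (1.15) p.249, (2.18) p.257; Balaban1989LargeFieldI, (0.3) p.176 (bookkeeping)] -/
theorem densOfRecord₁₃_liveRepin_reKey_eq_exp_mul (k : ℕ) (V : cfgOfRecord F N p.K k) :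
    densOfRecord₁₃ F N (({ θ with Efl := e, logz := z } : Stage13Params F N).liveRepin₁₃ F N) p k V
      = Real.exp (EOfRecord₁₃ F N θ p - EOfRecord₁₃ F N { θ with Efl := e, logz := z } p)
          * densOfRecord₁₃ F N (θ.liveRepin₁₃ F N) p k V := by
  show rhoOfRecord9 F N θ.ν θ.τ9 (EOfRecord₁₃ F N { θ with Efl := e, logz := z }) (wOfRecord₉ F N θ.toStage9Params)
      (({ θ with Efl := e, logz := z } : Stage13Params F N).liveRepin₁₃ F N).ppSel p (gOfRecord₁₃ F N θ p) k V = _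
  rw [liveRepin₁₃_reKey_ppSel]
  exact rhoOfRecord9_eq_exp_mul θ.ν θ.τ9 (EOfRecord₁₃ F N θ) (EOfRecord₁₃ F N { θ with Efl := e, logz := z })
    (wOfRecord₉ F N θ.toStage9Params) (θ.liveRepin₁₃ F N).ppSel p (gOfRecord₁₃ F N θ p) k V
end Stage13Live

/-! ## §4 The named z-witness family of record (DEF-1 Z2 `theta13OfThm1CCMWZ`) against its coupling-blind member `theta13OfThm1CCMW` -/

section ZWitness
variable (j : ℕ) (γ ε₀ ε₂₉ B₃ B₃' a₀ a₁ : ℝ) (e z : B12.RunParams → ℕ → ℝ) (p : B12.RunParams)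

/-- The z-witness's selector IS the blind witness's (liveness is letter-free). [cite: Balaban1989LargeFieldI, (0.3) p.176 and p.177; Balaban1989LargeFieldII, (0.15) p.360 (bookkeeping)] -/
theorem ppSel_theta13OfThm1CCMWZ :
    (theta13OfThm1CCMWZ F N j γ ε₀ ε₂₉ B₃ B₃' a₀ a₁ e z).ppSel = (theta13OfThm1CCMW F N j γ ε₀ ε₂₉ B₃ B₃' a₀ a₁).ppSel := by
  show ppSelLiveOfRecord F N (theta13OfThm1CCMW F N j γ ε₀ ε₂₉ B₃ B₃' a₀ a₁).ν (theta13OfThm1CCMW F N j γ ε₀ ε₂₉ B₃ B₃' a₀ a₁).τ9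
      (EOfRecord₁₃ F N (theta13OfThm1CCMWZ F N j γ ε₀ ε₂₉ B₃ B₃' a₀ a₁ e z)) (wOfRecord₉ F N (theta13OfThm1CCMW F N j γ ε₀ ε₂₉ B₃ B₃' a₀ a₁).toStage9Params)
    = ppSelLiveOfRecord F N (theta13OfThm1CCMW F N j γ ε₀ ε₂₉ B₃ B₃' a₀ a₁).ν (theta13OfThm1CCMW F N j γ ε₀ ε₂₉ B₃ B₃' a₀ a₁).τ9
      (EOfRecord₁₃ F N (theta13OfThm1CCMW F N j γ ε₀ ε₂₉ B₃ B₃' a₀ a₁)) (wOfRecord₉ F N (theta13OfThm1CCMW F N j γ ε₀ ε₂₉ B₃ B₃' a₀ a₁).toStage9Params)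
  exact ppSelLiveOfRecord_eq_of_normalisation _ _ _ _ _

/-- **★★ THE DENSITIES OF THE z-WITNESS OF RECORD** `θ₁₅ᶜᶜᴹᵂᶻ(…; e, z)` are `e^{E_W(p) − E_Z(p)}` times those of the coupling-blind witness `θ₁₅ᶜᶜᴹᵂ`, with
`E_W = EOfRecord₁₃ (θ₁₅ᶜᶜᴹᵂ)`, `E_Z = EOfRecord₁₃ (θ₁₅ᶜᶜᴹᵂᶻ(…; e, z))`: the letters enter the whole record tower ONLY through one positive constant per run. [cite: Balaban1988Convergent, Thm 1 p.262, (1.15) p.249, (2.18) p.257; Balaban1989LargeFieldII, (0.15) p.360 (bookkeeping)] -/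
theorem densOfRecord₁₃_theta13OfThm1CCMWZ_eq_exp_mul (k : ℕ) (V : cfgOfRecord F N p.K k) :
    densOfRecord₁₃ F N (theta13OfThm1CCMWZ F N j γ ε₀ ε₂₉ B₃ B₃' a₀ a₁ e z) p k V
      = Real.exp (EOfRecord₁₃ F N (theta13OfThm1CCMW F N j γ ε₀ ε₂₉ B₃ B₃' a₀ a₁) p
            - EOfRecord₁₃ F N (theta13OfThm1CCMWZ F N j γ ε₀ ε₂₉ B₃ B₃' a₀ a₁ e z) p)
          * densOfRecord₁₃ F N (theta13OfThm1CCMW F N j γ ε₀ ε₂₉ B₃ B₃' a₀ a₁) p k V := by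
  show rhoOfRecord9 F N (theta13OfThm1CCMW F N j γ ε₀ ε₂₉ B₃ B₃' a₀ a₁).ν (theta13OfThm1CCMW F N j γ ε₀ ε₂₉ B₃ B₃' a₀ a₁).τ9
      (EOfRecord₁₃ F N (theta13OfThm1CCMWZ F N j γ ε₀ ε₂₉ B₃ B₃' a₀ a₁ e z)) (wOfRecord₉ F N (theta13OfThm1CCMW F N j γ ε₀ ε₂₉ B₃ B₃' a₀ a₁).toStage9Params)
      (theta13OfThm1CCMWZ F N j γ ε₀ ε₂₉ B₃ B₃' a₀ a₁ e z).ppSel p (gOfRecord₁₃ F N (theta13OfThm1CCMW F N j γ ε₀ ε₂₉ B₃ B₃' a₀ a₁) p) k V = _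
  rw [ppSel_theta13OfThm1CCMWZ]
  exact rhoOfRecord9_eq_exp_mul _ _ _ _ _ _ p _ k V

/-- … and the T-stepped densities likewise. [cite: Balaban1988Convergent, (3.1) p.264, (3.25) p.270; Balaban1989LargeFieldII, (0.15) p.360 (bookkeeping)] -/
theorem tdensOfRecord₁₃_theta13OfThm1CCMWZ_eq_exp_mul (k : ℕ) (V : cfgOfRecord F N p.K (k + 1)) :
    tdensOfRecord₁₃ F N (theta13OfThm1CCMWZ F N j γ ε₀ ε₂₉ B₃ B₃' a₀ a₁ e z) p k V
      = Real.exp (EOfRecord₁₃ F N (theta13OfThm1CCMW F N j γ ε₀ ε₂₉ B₃ B₃' a₀ a₁) p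
            - EOfRecord₁₃ F N (theta13OfThm1CCMWZ F N j γ ε₀ ε₂₉ B₃ B₃' a₀ a₁ e z) p)
          * tdensOfRecord₁₃ F N (theta13OfThm1CCMW F N j γ ε₀ ε₂₉ B₃ B₃' a₀ a₁) p k V := by
  show trhoOfRecord9 F N (theta13OfThm1CCMW F N j γ ε₀ ε₂₉ B₃ B₃' a₀ a₁).ν (theta13OfThm1CCMW F N j γ ε₀ ε₂₉ B₃ B₃' a₀ a₁).τ9
      (EOfRecord₁₃ F N (theta13OfThm1CCMWZ F N j γ ε₀ ε₂₉ B₃ B₃' a₀ a₁ e z)) (wOfRecord₉ F N (theta13OfThm1CCMW F N j γ ε₀ ε₂₉ B₃ B₃' a₀ a₁).toStage9Params)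
      (theta13OfThm1CCMWZ F N j γ ε₀ ε₂₉ B₃ B₃' a₀ a₁ e z).ppSel p (gOfRecord₁₃ F N (theta13OfThm1CCMW F N j γ ε₀ ε₂₉ B₃ B₃' a₀ a₁) p) k V = _
  rw [ppSel_theta13OfThm1CCMWZ]
  exact trhoOfRecord9_eq_exp_mul _ _ _ _ _ _ p _ k V
end ZWitness

/-! ## §5 The constant itself: `E_{θ'}(p) − E_θ(p)` is the explicit letter sum (the histories are letter-free) -/

section DeltaE
omit [NeZero N] in
/-- The normalisation of record is AFFINE in the letters: for one coupling history `g`, `E[Efl', logz'](p) − E[Efl, logz](p) = Σ_{j<K} ((Efl' − Efl) p j − (logz' − logz) p j · (L⁴ − 1)|T₁^{(j+1)}|)`. [cite: Balaban1988Convergent, (1.15) p.249, p.254, Thm 1 p.262 (bookkeeping)] -/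
theorem EOfRecord_sub_EOfRecord (ν : Stage7Numerics) (Efl logz Efl' logz' : B12.RunParams → ℕ → ℝ) (g : B12.RunParams → ℕ → ℝ) (p : B12.RunParams) :
    EOfRecord F N ν Efl' logz' g p - EOfRecord F N ν Efl logz g p
      = ∑ j ∈ Finset.range p.K, ((Efl' p j - Efl p j) - (logz' p j - logz p j) * ((((F.P p.K).L : ℝ) ^ 4 - 1) * sitesCard (F.P p.K) (j + 1))) := by
  unfold EOfRecord eStepOfRecord
  rw [← Finset.sum_sub_distrib]
  refine Finset.sum_congr rfl fun j _ => ?_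
  ring

variable (j : ℕ) (γ ε₀ ε₂₉ B₃ B₃' a₀ a₁ : ℝ) (e z : B12.RunParams → ℕ → ℝ) (p : B12.RunParams)

/-- **THE z-WITNESS's CONSTANT**: `E_Z(p) − E_W(p) = Σ_{j<K} (e p j − z p j · (L⁴ − 1)|T₁^{(j+1)}|)` — the blind witness has `Efl = logz = 0` and the SAME histories. [cite: Balaban1988Convergent, (1.15) p.249, Thm 1 p.262; Balaban1989LargeFieldII, (0.15) p.360 (bookkeeping)] -/
theorem EOfRecord₁₃_theta13OfThm1CCMWZ_sub :
    EOfRecord₁₃ F N (theta13OfThm1CCMWZ F N j γ ε₀ ε₂₉ B₃ B₃' a₀ a₁ e z) p - EOfRecord₁₃ F N (theta13OfThm1CCMW F N j γ ε₀ ε₂₉ B₃ B₃' a₀ a₁) p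
      = ∑ i ∈ Finset.range p.K, (e p i - z p i * ((((F.P p.K).L : ℝ) ^ 4 - 1) * sitesCard (F.P p.K) (i + 1))) := by
  have h := EOfRecord_sub_EOfRecord (F := F) (N := N) (theta13OfThm1CCMW F N j γ ε₀ ε₂₉ B₃ B₃' a₀ a₁).ν (fun _ _ => 0) (fun _ _ => 0) e z
    (fun q => gOfRecord₁₃ F N (theta13OfThm1CCMW F N j γ ε₀ ε₂₉ B₃ B₃' a₀ a₁) q) p
  simp only [sub_zero] at h
  exact h
end DeltaE

/-! ## §6 A first E-reading ROW transferred: `SlotsNondegenerate₁₃` at the z-witness ⟺ at the blind witness (non-vanishing ignores a positive run-constant) -/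

section Nondegenerate
variable (j : ℕ) (γ ε₀ ε₂₉ B₃ B₃' a₀ a₁ : ℝ) (e z : B12.RunParams → ℕ → ℝ)

/-- **`SlotsNondegenerate₁₃` IS LETTER-FREE ON THE z-WITNESS FAMILY**: the z-witness `θ₁₅ᶜᶜᴹᵂᶻ(…; e, z)` has non-degenerate slots iff the coupling-blind witness `θ₁₅ᶜᶜᴹᵂ` has — same
selector (§4), slots rescaled by the positive run-constant `exp (E_W p − E_Z p)` (§2). [cite: Balaban1989LargeFieldI, (0.3) p.176 and p.177; Balaban1988Convergent, (2.18) p.257, Thm 1 p.262 (bookkeeping)] -/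
theorem slotsNondegenerate₁₃_theta13OfThm1CCMWZ_iff :
    (theta13OfThm1CCMWZ F N j γ ε₀ ε₂₉ B₃ B₃' a₀ a₁ e z).SlotsNondegenerate₁₃ F N
      ↔ (theta13OfThm1CCMW F N j γ ε₀ ε₂₉ B₃ B₃' a₀ a₁).SlotsNondegenerate₁₃ F N := by
  have hsel := ppSel_theta13OfThm1CCMWZ (F := F) (N := N) j γ ε₀ ε₂₉ B₃ B₃' a₀ a₁ e z
  have hE := slotsOfRecord_eq_exp_mul (theta13OfThm1CCMW F N j γ ε₀ ε₂₉ B₃ B₃' a₀ a₁).ν (theta13OfThm1CCMW F N j γ ε₀ ε₂₉ B₃ B₃' a₀ a₁).τ9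
    (EOfRecord₁₃ F N (theta13OfThm1CCMW F N j γ ε₀ ε₂₉ B₃ B₃' a₀ a₁)) (EOfRecord₁₃ F N (theta13OfThm1CCMWZ F N j γ ε₀ ε₂₉ B₃ B₃' a₀ a₁ e z))
    (wOfRecord₉ F N (theta13OfThm1CCMW F N j γ ε₀ ε₂₉ B₃ B₃' a₀ a₁).toStage9Params) (theta13OfThm1CCMW F N j γ ε₀ ε₂₉ B₃ B₃' a₀ a₁).ppSel
  show (∀ (p : B12.RunParams) (k : ℕ)
      (s : SeqOfRecord F (theta13OfThm1CCMW F N j γ ε₀ ε₂₉ B₃ B₃' a₀ a₁).ν (theta13OfThm1CCMW F N j γ ε₀ ε₂₉ B₃ B₃' a₀ a₁).τ9.M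
        (gOfRecord₁₃ F N (theta13OfThm1CCMW F N j γ ε₀ ε₂₉ B₃ B₃' a₀ a₁) p) p.K k), k ≤ p.K →
      s ∈ Set.range ((theta13OfThm1CCMWZ F N j γ ε₀ ε₂₉ B₃ B₃' a₀ a₁ e z).ppSel p (gOfRecord₁₃ F N (theta13OfThm1CCMW F N j γ ε₀ ε₂₉ B₃ B₃' a₀ a₁) p) k) →
        slotsOfRecord F N (theta13OfThm1CCMW F N j γ ε₀ ε₂₉ B₃ B₃' a₀ a₁).ν (theta13OfThm1CCMW F N j γ ε₀ ε₂₉ B₃ B₃' a₀ a₁).τ9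
          (EOfRecord₁₃ F N (theta13OfThm1CCMWZ F N j γ ε₀ ε₂₉ B₃ B₃' a₀ a₁ e z)) (wOfRecord₉ F N (theta13OfThm1CCMW F N j γ ε₀ ε₂₉ B₃ B₃' a₀ a₁).toStage9Params)
          (theta13OfThm1CCMWZ F N j γ ε₀ ε₂₉ B₃ B₃' a₀ a₁ e z).ppSel p (gOfRecord₁₃ F N (theta13OfThm1CCMW F N j γ ε₀ ε₂₉ B₃ B₃' a₀ a₁) p) k s ≠ 0) ↔ _
  rw [hsel]
  unfold Stage13Params.SlotsNondegenerate₁₃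
  constructor
  · intro h p k s hk hs h0
    refine h p k s hk hs ?_
    rw [hE p (gOfRecord₁₃ F N (theta13OfThm1CCMW F N j γ ε₀ ε₂₉ B₃ B₃' a₀ a₁) p) k]
    funext V
    show Real.exp _ * _ = (0 : cfgOfRecord F N p.K k → ℝ) V
    rw [h0]
    simp
  · intro h p k s hk hs h0
    refine h p k s hk hs ?_
    rw [hE p (gOfRecord₁₃ F N (theta13OfThm1CCMW F N j γ ε₀ ε₂₉ B₃ B₃' a₀ a₁) p) k] at h0
    funext V
    have hV := congrFun h0 V
    have hexp : Real.exp (EOfRecord₁₃ F N (theta13OfThm1CCMW F N j γ ε₀ ε₂₉ B₃ B₃' a₀ a₁) p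
        - EOfRecord₁₃ F N (theta13OfThm1CCMWZ F N j γ ε₀ ε₂₉ B₃ B₃' a₀ a₁ e z) p) ≠ 0 := Real.exp_ne_zero _
    have : Real.exp (EOfRecord₁₃ F N (theta13OfThm1CCMW F N j γ ε₀ ε₂₉ B₃ B₃' a₀ a₁) p
        - EOfRecord₁₃ F N (theta13OfThm1CCMWZ F N j γ ε₀ ε₂₉ B₃ B₃' a₀ a₁ e z) p) * _ = (0 : cfgOfRecord F N p.K k → ℝ) V := hV
    simpa [hexp] using this
end Nondegenerate

end Summit.QuantumFields.YangMills.BalabanUVNodes.RecordTowerNormalisationCovariance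

end
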